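import Mathlib
import Summits.ValiantsHypothesis.ValiantsHypothesis.Theorems.NewtonUnitEquationsDissociatedUniformTorusLogKCell

/-!
# The torus stratum of crux `DissociatedUniform` has exponent `O(log k)` — II: the theorem

Line `greedy-basis-shadow` of crux stmt-ValiantsHypothesis-5905 `NewtonUnitEquations.DissociatedUniform`, lead c6 by-product.
See part I (`…TorusLogKCell`) for the mechanism (per cell, greedy words of a torus frame live on `≤ k²` coordinates:
depth `≤ k-1` + cross-novelty + the colored novelty lemma).  Here: cells and charts are summed exactly as in
`stub_cellDecomposition` (`ncard_fshadow_le`), vertices are shadow points (`torusLogK`), and the bound is rewritten in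
the crux's shape `(k·m·t + 2)^(20⌈log₂ k⌉ + 9)` (`torusLogK_cruxShape`; compare Theorem Q's `5⌈log₂ m⌉ + 1`,
`dissociated_logExponent`): on torus frames the exponent may be taken logarithmic in `k` uniformly in `m, t`, so the
count is polynomial in `(m, t)` whenever `k ≤ 2^O(√log m)`.
-/

set_option linter.dupNamespace false

noncomputable section

open scoped BigOperators

namespace Summit.ValiantsHypothesis.ValiantsHypothesis.Theorems.NewtonUnitEquationsDissociatedUniform

namespace TorusLogK

/-- **Shadow bound on torus frames.**  `|fshadow A f| ≤ 2(((m t²)² + 1)·Q(k) + (m t²)²·k) + 2k + 1` with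
`Q(k) = (k² + 3)(8(k+2)³)^⌈log₂ k²⌉` — cells (`CellDecomposition.ncard_pencil_le`) and charts
(`QuasiPoly.ncard_cshadow_le_charts`) summed over the per-cell bound `perCell`. -/
theorem ncard_fshadow_le (k m t : ℕ) (A : Fin m → Finset (Fin 2 →₀ ℕ)) (f : Fin k → Fin m → MvPolynomial (Fin 2) ℂ)
    (hcard : ∀ j, (A j).card ≤ t) (htorus : ∀ i j, ∀ l ∈ A j, (f i j).coeff l ≠ 0) :
    (QuasiPoly.fshadow A f).ncard ≤
      2 * (((m * t ^ 2) ^ 2 + 1) * ((k * k + 3) * (8 * (k + 2) ^ 3) ^ Nat.clog 2 (k * k)) + (m * t ^ 2) ^ 2 * k) +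
        k + k + 1 := by
  set Q := (k * k + 3) * (8 * (k + 2) ^ 3) ^ Nat.clog 2 (k * k) with hQ
  have hchart : ∀ ε : ℝ, ∀ u : (Fin m → (Fin 2 →₀ ℕ)) → ℝ, (∀ a, u a = ε * QuasiPoly.Xf a) →
      (QuasiPoly.chartShadow (Fintype.piFinset A) (QuasiPoly.col f) u QuasiPoly.Yf).ncard ≤
        ((m * t ^ 2) ^ 2 + 1) * Q + (m * t ^ 2) ^ 2 * k := by
    intro ε u hu
    have hH : ∀ lam : ℝ, (fun e : Fin m → (Fin 2 →₀ ℕ) => u e + lam * QuasiPoly.Yf e) =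
        fun a : Fin m → (Fin 2 →₀ ℕ) => ε * QuasiPoly.Xf a + lam * QuasiPoly.Yf a := by
      intro lam
      funext a
      rw [hu]
    exact le_trans
      (Set.ncard_le_ncard
        (CellDecomposition.chartShadow_subset_pencil (Fintype.piFinset A) (QuasiPoly.col f) u QuasiPoly.Yf
          (fun (lam : ℝ) (a : Fin m → (Fin 2 →₀ ℕ)) => ε * QuasiPoly.Xf a + lam * QuasiPoly.Yf a) hH)
        (CellDecomposition.pencil_finite _ _ _))
      (CellDecomposition.ncard_pencil_le (Fintype.piFinset A) (QuasiPoly.col f)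
        (fun (lam : ℝ) (a : Fin m → (Fin 2 →₀ ℕ)) => ε * QuasiPoly.Xf a + lam * QuasiPoly.Yf a) A
        (fun l : Fin 2 →₀ ℕ => ((l 0 : ℕ) : ℝ)) (fun l : Fin 2 →₀ ℕ => ((l 1 : ℕ) : ℝ)) ε Q t hcard
        (fun Λ hc => perCell k m A f htorus ε Λ hc))
  have hpos := hchart 1 QuasiPoly.Xf fun a => (one_mul _).symm
  have hneg := hchart (-1) (fun e => -QuasiPoly.Xf e) fun a => (neg_one_mul _).symm
  have hdec := QuasiPoly.ncard_cshadow_le_charts (Fintype.piFinset A) (QuasiPoly.col f) QuasiPoly.Xf QuasiPoly.Yf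
  calc (QuasiPoly.fshadow A f).ncard
      = (QuasiPoly.cshadow (Fintype.piFinset A) (QuasiPoly.col f) QuasiPoly.Xf QuasiPoly.Yf).ncard := rfl
    _ ≤ _ := hdec
    _ ≤ (((m * t ^ 2) ^ 2 + 1) * Q + (m * t ^ 2) ^ 2 * k) + (((m * t ^ 2) ^ 2 + 1) * Q + (m * t ^ 2) ^ 2 * k) +
          k + k + 1 := by gcongr
    _ = 2 * (((m * t ^ 2) ^ 2 + 1) * Q + (m * t ^ 2) ^ 2 * k) + k + k + 1 := by ring

/-- **Theorem (torus stratum, exponent `O(log k)`).**  On a dissociated TORUS frame (no coefficient of a letter of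
the alphabet vanishes) with `≤ t` letters per coordinate, the Newton polygon of `Σ_{i<k} Π_{j<m} f i j` has at most
`2(((m t²)² + 1)·(k² + 3)(8(k+2)³)^⌈log₂ k²⌉ + (m t²)²·k) + 2k + 1 = poly(m, t)·k^O(log k)` vertices. -/
theorem torusLogK (k m t : ℕ) (A : Fin m → Finset (Fin 2 →₀ ℕ)) (f : Fin k → Fin m → MvPolynomial (Fin 2) ℂ)
    (hcard : ∀ j, (A j).card ≤ t) (hsupp : ∀ i j, (f i j).support ⊆ A j)
    (hdis : ∀ a b : Fin m → (Fin 2 →₀ ℕ), (∀ j, a j ∈ A j) → (∀ j, b j ∈ A j) → ∑ j, a j = ∑ j, b j → a = b)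
    (htorus : ∀ i j, ∀ l ∈ A j, (f i j).coeff l ≠ 0) :
    (Set.extremePoints ℝ (convexHull ℝ ((fun e : Fin 2 →₀ ℕ => fun i : Fin 2 => ((e i : ℕ) : ℝ)) ''
      ((∑ i, ∏ j, f i j).support : Set (Fin 2 →₀ ℕ))))).ncard ≤
      2 * (((m * t ^ 2) ^ 2 + 1) * ((k * k + 3) * (8 * (k + 2) ^ 3) ^ Nat.clog 2 (k * k)) + (m * t ^ 2) ^ 2 * k) +
        k + k + 1 := by
  calc (Set.extremePoints ℝ (convexHull ℝ ((fun e : Fin 2 →₀ ℕ => fun i : Fin 2 => ((e i : ℕ) : ℝ)) ''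
      ((∑ i, ∏ j, f i j).support : Set (Fin 2 →₀ ℕ))))).ncard
      ≤ ((fun a : Fin m → (Fin 2 →₀ ℕ) => fun i : Fin 2 => (((∑ j, a j) i : ℕ) : ℝ)) '' QuasiPoly.fshadow A f).ncard :=
        Set.ncard_le_ncard (QuasiPoly.extremePoints_subset_image_fshadow A f hsupp hdis)
          ((QuasiPoly.cshadow_finite _ _ _ _).image _)
    _ ≤ (QuasiPoly.fshadow A f).ncard := Set.ncard_image_le (QuasiPoly.cshadow_finite _ _ _ _)
    _ ≤ _ := ncard_fshadow_le k m t A f hcard htorus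

/-- `⌈log₂ k²⌉ ≤ 2 ⌈log₂ k⌉`. -/
theorem clog_sq_le (k : ℕ) : Nat.clog 2 (k * k) ≤ 2 * Nat.clog 2 k := by
  have hk : k ≤ 2 ^ Nat.clog 2 k := Nat.le_pow_clog one_lt_two k
  calc Nat.clog 2 (k * k) ≤ Nat.clog 2 (2 ^ Nat.clog 2 k * 2 ^ Nat.clog 2 k) :=
        Nat.clog_mono_right 2 (Nat.mul_le_mul hk hk)
    _ = 2 * Nat.clog 2 k := by rw [← pow_add, Nat.clog_pow 2 _ one_lt_two]; ring

/-- **The torus theorem in the shape of the crux**: on a dissociated torus frame the crux's bound `(k·m·t + 2)^C`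
holds with `C = 20·⌈log₂ k⌉ + 9` — logarithmic in `k`, uniformly in `m` and `t` (compare Theorem Q's
`5⌈log₂ m⌉ + 1`, `dissociated_logExponent`). -/
theorem torusLogK_cruxShape (k m t : ℕ) (A : Fin m → Finset (Fin 2 →₀ ℕ))
    (f : Fin k → Fin m → MvPolynomial (Fin 2) ℂ) (hcard : ∀ j, (A j).card ≤ t)
    (hsupp : ∀ i j, (f i j).support ⊆ A j)
    (hdis : ∀ a b : Fin m → (Fin 2 →₀ ℕ), (∀ j, a j ∈ A j) → (∀ j, b j ∈ A j) → ∑ j, a j = ∑ j, b j → a = b)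
    (htorus : ∀ i j, ∀ l ∈ A j, (f i j).coeff l ≠ 0) :
    (Set.extremePoints ℝ (convexHull ℝ ((fun e : Fin 2 →₀ ℕ => fun i : Fin 2 => ((e i : ℕ) : ℝ)) ''
      ((∑ i, ∏ j, f i j).support : Set (Fin 2 →₀ ℕ))))).ncard ≤ (k * m * t + 2) ^ (20 * Nat.clog 2 k + 9) := by
  classical
  have hT := torusLogK k m t A f hcard hsupp hdis htorus
  -- the vanishing cases: `k = 0`, or `t = 0 < m`
  have hzero : (∑ i, ∏ j, f i j) = 0 →
      (Set.extremePoints ℝ (convexHull ℝ ((fun e : Fin 2 →₀ ℕ => fun i : Fin 2 => ((e i : ℕ) : ℝ)) ''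
        ((∑ i, ∏ j, f i j).support : Set (Fin 2 →₀ ℕ))))).ncard ≤ (k * m * t + 2) ^ (20 * Nat.clog 2 k + 9) := by
    intro h
    have hE : Set.extremePoints ℝ (convexHull ℝ ((fun e : Fin 2 →₀ ℕ => fun i : Fin 2 => ((e i : ℕ) : ℝ)) ''
        ((∑ i, ∏ j, f i j).support : Set (Fin 2 →₀ ℕ)))) = ∅ := by
      apply Set.subset_empty_iff.mp
      intro e he
      have := extremePoints_convexHull_subset he
      simp [h] at this
    rw [hE, Set.ncard_empty]
    exact Nat.zero_le _
  rcases Nat.eq_zero_or_pos k with rfl | hk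
  · exact hzero (by simp)
  rcases Nat.eq_zero_or_pos m with rfl | hm
  · -- `m = 0`: at most one support point
    have hsub : ((∑ i : Fin k, ∏ j : Fin 0, f i j).support : Set (Fin 2 →₀ ℕ)) ⊆ {0} := by
      intro e he
      have h1 : (∑ i : Fin k, ∏ j : Fin 0, f i j) = MvPolynomial.C (k : ℂ) := by simp
      rw [Finset.mem_coe, h1, MvPolynomial.mem_support_iff, MvPolynomial.coeff_C] at he
      by_contra hne
      have h0e : (0 : Fin 2 →₀ ℕ) ≠ e := fun h => hne (by rw [← h]; exact Set.mem_singleton _)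
      rw [if_neg h0e] at he
      exact he rfl
    calc _ ≤ ((fun e : Fin 2 →₀ ℕ => fun i : Fin 2 => ((e i : ℕ) : ℝ)) ''
          ((∑ i : Fin k, ∏ j : Fin 0, f i j).support : Set (Fin 2 →₀ ℕ))).ncard :=
          Set.ncard_le_ncard extremePoints_convexHull_subset ((Finset.finite_toSet _).image _)
      _ ≤ ((∑ i : Fin k, ∏ j : Fin 0, f i j).support : Set (Fin 2 →₀ ℕ)).ncard := Set.ncard_image_le (Finset.finite_toSet _)
      _ ≤ ({0} : Set (Fin 2 →₀ ℕ)).ncard := Set.ncard_le_ncard hsub (Set.finite_singleton _)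
      _ = 1 := Set.ncard_singleton _
      _ ≤ (k * 0 * t + 2) ^ (20 * Nat.clog 2 k + 9) := Nat.one_le_pow _ _ (by omega)
  rcases Nat.eq_zero_or_pos t with rfl | ht
  · apply hzero
    have hj : A ⟨0, hm⟩ = ∅ := Finset.card_eq_zero.mp (Nat.le_zero.mp (hcard ⟨0, hm⟩))
    have hf : ∀ i, f i ⟨0, hm⟩ = 0 := by
      intro i
      have := hsupp i ⟨0, hm⟩
      rw [hj, Finset.subset_empty, MvPolynomial.support_eq_empty] at this
      exact this
    refine Finset.sum_eq_zero fun i _ => ?_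
    exact Finset.prod_eq_zero (Finset.mem_univ (⟨0, hm⟩ : Fin m)) (hf i)
  -- the main case `k, m, t ≥ 1`
  set x := k * m * t + 2 with hx
  set c := Nat.clog 2 k with hc
  have hkmt : 1 ≤ k * m * t := Nat.mul_pos (Nat.mul_pos hk hm) ht
  have hx3 : 3 ≤ x := by omega
  have hkx : k + 2 ≤ x := by
    have : k ≤ k * m * t := by
      calc k = k * 1 * 1 := by ring
        _ ≤ k * m * t := Nat.mul_le_mul (Nat.mul_le_mul le_rfl hm) ht
    omega
  have hmt : m * t ^ 2 ≤ x ^ 2 := by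
    have h1 : m * t ≤ k * m * t := by
      calc m * t = 1 * m * t := by ring
        _ ≤ k * m * t := Nat.mul_le_mul (Nat.mul_le_mul hk le_rfl) le_rfl
    have h2 : t ≤ k * m * t := by
      calc t = 1 * 1 * t := by ring
        _ ≤ k * m * t := Nat.mul_le_mul (Nat.mul_le_mul hk hm) le_rfl
    calc m * t ^ 2 = (m * t) * t := by ring
      _ ≤ (k * m * t) * (k * m * t) := Nat.mul_le_mul h1 h2
      _ ≤ x * x := Nat.mul_le_mul (by omega) (by omega)
      _ = x ^ 2 := by ring
  have hβ : 8 * (k + 2) ^ 3 ≤ x ^ 5 := by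
    have h8 : 8 ≤ x ^ 2 := by nlinarith
    calc 8 * (k + 2) ^ 3 ≤ x ^ 2 * x ^ 3 := Nat.mul_le_mul h8 (Nat.pow_le_pow_left hkx 3)
      _ = x ^ 5 := by ring
  have hk3 : k * k + 3 ≤ x ^ 2 := by nlinarith
  have hQ : (k * k + 3) * (8 * (k + 2) ^ 3) ^ Nat.clog 2 (k * k) ≤ x ^ (10 * c + 2) := by
    calc (k * k + 3) * (8 * (k + 2) ^ 3) ^ Nat.clog 2 (k * k)
        ≤ x ^ 2 * (x ^ 5) ^ Nat.clog 2 (k * k) := Nat.mul_le_mul hk3 (Nat.pow_le_pow_left hβ _)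
      _ ≤ x ^ 2 * (x ^ 5) ^ (2 * c) :=
          Nat.mul_le_mul_left _ (Nat.pow_le_pow_right (by positivity) (clog_sq_le k))
      _ = x ^ (10 * c + 2) := by rw [← pow_mul, ← pow_add]; ring_nf
  have hA1 : (m * t ^ 2) ^ 2 + 1 ≤ x ^ 5 := by
    have : (m * t ^ 2) ^ 2 ≤ x ^ 4 := by
      calc (m * t ^ 2) ^ 2 ≤ (x ^ 2) ^ 2 := Nat.pow_le_pow_left hmt 2
        _ = x ^ 4 := by ring
    have hx4 : 1 ≤ x ^ 4 := Nat.one_le_pow _ _ (by omega)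
    calc (m * t ^ 2) ^ 2 + 1 ≤ x ^ 4 + x ^ 4 := by omega
      _ = 2 * x ^ 4 := by ring
      _ ≤ x * x ^ 4 := Nat.mul_le_mul_right _ (by omega)
      _ = x ^ 5 := by ring
  have hA2 : (m * t ^ 2) ^ 2 * k ≤ x ^ 5 := by
    calc (m * t ^ 2) ^ 2 * k ≤ (x ^ 2) ^ 2 * x := Nat.mul_le_mul (Nat.pow_le_pow_left hmt 2) (by omega)
      _ = x ^ 5 := by ring
  have hkk : k + k + 1 ≤ x ^ 2 := by nlinarith
  have hx1 : 1 ≤ x := by omega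
  calc _ ≤ 2 * (((m * t ^ 2) ^ 2 + 1) * ((k * k + 3) * (8 * (k + 2) ^ 3) ^ Nat.clog 2 (k * k)) +
          (m * t ^ 2) ^ 2 * k) + k + k + 1 := hT
    _ ≤ 2 * (x ^ 5 * x ^ (10 * c + 2) + x ^ 5) + x ^ 2 := by
        have := Nat.mul_le_mul hA1 hQ
        omega
    _ ≤ 2 * (x ^ 5 * x ^ (10 * c + 2) + x ^ 5 * x ^ (10 * c + 2)) + x ^ 5 * x ^ (10 * c + 2) := by
        have h1 : x ^ 5 ≤ x ^ 5 * x ^ (10 * c + 2) :=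
          Nat.le_mul_of_pos_right _ (Nat.pow_pos (by omega))
        have h2 : x ^ 2 ≤ x ^ 5 * x ^ (10 * c + 2) := by
          calc x ^ 2 ≤ x ^ 5 := Nat.pow_le_pow_right hx1 (by omega)
            _ ≤ x ^ 5 * x ^ (10 * c + 2) := h1
        omega
    _ = 5 * x ^ (10 * c + 7) := by rw [← pow_add]; ring_nf
    _ ≤ x ^ 2 * x ^ (10 * c + 7) := Nat.mul_le_mul_right _ (by nlinarith)
    _ = x ^ (10 * c + 9) := by rw [← pow_add]; ring_nf
    _ ≤ x ^ (20 * c + 9) := Nat.pow_le_pow_right hx1 (by omega)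

end TorusLogK

/-- **Theorem (torus stratum, exponent `O(log k)`)** — export of `TorusLogK.torusLogK`, registered by-product stub
`torus_logK`: on a dissociated torus frame with `≤ t` letters per coordinate the Newton polygon of
`Σ_{i<k} Π_{j<m} f i j` has at most `2(((m t²)² + 1)(k² + 3)(8(k+2)³)^⌈log₂ k²⌉ + (m t²)² k) + 2k + 1` vertices. -/
theorem torus_logK (k m t : ℕ) (A : Fin m → Finset (Fin 2 →₀ ℕ)) (f : Fin k → Fin m → MvPolynomial (Fin 2) ℂ) (hcard : ∀ j, (A j).card ≤ t) (hsupp : ∀ i j, (f i j).support ⊆ A j) (hdis : ∀ a b : Fin m → (Fin 2 →₀ ℕ), (∀ j, a j ∈ A j) → (∀ j, b j ∈ A j) → ∑ j, a j = ∑ j, b j → a = b) (htorus : ∀ i j, ∀ l ∈ A j, (f i j).coeff l ≠ 0) : (Set.extremePoints ℝ (convexHull ℝ ((fun e : Fin 2 →₀ ℕ => fun i : Fin 2 => ((e i : ℕ) : ℝ)) '' ((∑ i, ∏ j, f i j).support : Set (Fin 2 →₀ ℕ))))).ncard ≤ 2 * (((m * t ^ 2) ^ 2 + 1) * ((k * k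 + 3) * (8 * (k + 2) ^ 3) ^ Nat.clog 2 (k * k)) + (m * t ^ 2) ^ 2 * k) + k + k + 1 :=
  TorusLogK.torusLogK k m t A f hcard hsupp hdis htorus

/-- **The torus theorem in the shape of the crux** — export of `TorusLogK.torusLogK_cruxShape`, registered by-product
stub `torus_logK_cruxShape`: `#vert ≤ (k·m·t + 2)^(20⌈log₂ k⌉ + 9)` on dissociated torus frames. -/
theorem torus_logK_cruxShape (k m t : ℕ) (A : Fin m → Finset (Fin 2 →₀ ℕ)) (f : Fin k → Fin m → MvPolynomial (Fin 2) ℂ) (hcard : ∀ j, (A j).card ≤ t) (hsupp : ∀ i j, (f i j).support ⊆ A j) (hdis : ∀ a b : Fin m → (Fin 2 →₀ ℕ), (∀ j, a j ∈ A j) → (∀ j, b j ∈ A j) → ∑ j, a j = ∑ j, b j → a = b) (htorus : ∀ i j, ∀ l ∈ A j, (f i j).coeff l ≠ 0) : (Set.extremePoints ℝ (convexHull ℝ ((fun e : Fin 2 →₀ ℕ => fun i : Fin 2 => ((e i : ℕ) : ℝ)) '' ((∑ i, ∏ j, f i j).support : Set (Fin 2 →₀ ℕ))))).ncard ≤ (k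 * m * t + 2) ^ (20 * Nat.clog 2 k + 9) :=
  TorusLogK.torusLogK_cruxShape k m t A f hcard hsupp hdis htorus

end Summit.ValiantsHypothesis.ValiantsHypothesis.Theorems.NewtonUnitEquationsDissociatedUniform

end
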